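import Summits.ABC.IUTFork.Repair.RHDiffPriced
import Summits.ABC.IUTFork.Repair.RHTameBandLicence
import HarnessLib

/-!
# IUT REPAIR branch → R-H ROUND 1 (D-0079 / D-0107): row 16 «diffpriced» READ AGAINST row 5 «tame-band-licence» —
# H⋆_𝔡 ⟹ H⋆₅ at every genuine `K`-level datum (strictly), hence H⋆_𝔡 inherits row 5's unramified refutation and row 5's k2 door

PROOF-ONLY file (0 definitions, no instance, no notation) of the abc-iut cell, seat abc-iut-rh-typ-5 (R-H ROUND 1 PAIR n = 5 TYPER, row 16
after row 5 per rh-lead 17:33:57Z), rung LADDER-ABC:A2.RESCUE.H. TAKES NO SIDE on [IUTchIII] Cor. 3.12 or on any author; `HStarDiffPriced`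
(abc-iut-lens-transfer-3, re-homed by abc-iut-rp-s2, p458364) and `HStarTameBandLicence` (this seat, p458742) are claim-tagged CANDIDATE HYPOTHESES,
never facts; typed ≠ proved; refuted-as-typed ≠ refuted-in-print. Everything is consumed BY NAME: `RH.DiffPriced.Cell` / `HStarDiffPriced`,
`RH.TameBandLicence.Cell` / `HStarTameBandLicence` / `cell_of_bandTop` / `not_hStar_of_unramified_bad` /
`exists_qPinned_and_hull_settingPrVolSharp_pilotDataOfK_of_hStar_of_tame`, `Literature.IUT.LogVolume.differentOrd_eq_of_not_dvd`
([SerreLocalFields1979] III §6 Prop. 13: tame different `δ_w = e_w − 1`), `absRamificationIdx_rescaledCompletion`.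

WHAT IS PROVED (namespace `Summit.ABC.IUTFork.Repair.RH.DiffPricedVsTameBand`):
* `hStarDiffPriced_iff` — CARD↔tree probe: the landed Prop `HStarDiffPriced D` unfolds LITERALLY to the CARD's sentence «∀ bad w ∣ p, ∀ j = i+1:
  (j²−1)·P_w ≤ j·(e_w·d_w)», `P_w = qPilot w`, `e_w = absRamificationIdx p K_w`, `d_w = differentOrd p K_w` (`Iff.rfl`).
* **`hStarTameBandLicence_of_hStarDiffPriced`** — ROW 16 ⟹ ROW 5 at every genuine datum: at a TAME bad place (`p > 2`, `e_w ≤ p − 2`, so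
  `p ∤ e_w` and `e_w·d_w = e_w − 1`) the different-priced cell `(j²−1)·P_w ≤ j·(e_w − 1)` is the band top `θ_j = j`, which implies row 5's
  cell `(j²−1)·P_w ≤ j·(e_w−1) + ((j²P_w − 1) mod e_w)` (`TameBandLicence.cell_of_bandTop`); row 16 says nothing row 5 needs at wild places
  (row 5 makes no claim there).
* `strict_witnesses` — the converse FAILS cell-wise: `(e, P, j) = (5, 3, 2)` (HEX:3:5@p7.j2.ev1), `(2, 1, 2)` (S-X72@p7.j2), `(35, 15, 3)`
  (frey tame rows at `l = 7`, `H = 6`): row 5's cell HOLDS, row 16's tame cell FAILS — exactly the 15 (datum, p, type) groups of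
  I06STAR-COLUMNS v4.1 on which the two rows differ inside row 5's scope (seat-side second engine, HOME/abc-iut-rh-typ-5).
* `not_hStarDiffPriced_of_unramified_bad` — ONE bad place with `e_w = 1`, `p > 2` refutes H⋆_𝔡 as typed (through row 5's
  `not_hStar_of_unramified_bad`): the CARD's declared H4 line «e_w = 1 ⇒ NEG», now a theorem at the genuine datum.
* `exists_qPinned_and_hull_settingPrVolSharp_pilotDataOfK_of_hStarDiffPriced_of_tame` — the START-HERE §3 (k2) TARGET SHAPE for row 16 on
  the tame stratum («∃ ρ qK, QPinned ∧ PilotKummerCompatHull» at `settingPrVolSharp (pilotDataOfK D K) …`, all bad fibres uniformly tame,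
  realising ideles) — the CARD's «S_H antecedent form … left to the k2 hand», obtained from row 5's door; the licence form is abc-iut-rp-s2's
  `RH.DiffPriced.licence_settingPrVolSharp_pilotDataOfK_of_hStar_tame` (p458364) / `RHBandTopTame` (p457138), not restated.
[cite: Mochizuki2012, IUTchI Def. 3.1 (b),(c) pp. 61–62, Ex. 3.2 (iv) p. 71; IUTchIII Step (xi-f) p. 184; IUTchIV Prop. 1.1 p. 9, Prop. 1.2 (i)(ii) p. 10]
[cite: SerreLocalFields1979, Ch. III §6 Prop. 13] [cite: DupuyHilado2025, §3.3, §3.4, §4.9] [claim: Mochizuki2012, status: disputed] for every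
IUT sentence quoted. Axioms: standard.
-/

noncomputable section

open Set Metric Function NumberField IsDedekindDomain
open scoped Pointwise

namespace Summit.ABC.IUTFork.Repair.RH.DiffPricedVsTameBand

open Literature.AnabelianGeometry.AbsoluteAnabelian Literature.IUT.LogThetaLattice Literature.IUT.LogVolume
  Literature.IUT.HodgeTheaters Literature.NumberTheory.NumberFields Literature.NumberTheory.GaloisRepresentations.Ultrametric
open Summit.ABC.IUTFork.Thm311 Summit.ABC.IUTFork.Thm311.Real Summit.ABC.IUTFork.Cor312 Summit.ABC.IUTFork.Cor312.Setting
  Summit.ABC.IUTFork.Cor312Vol Summit.ABC.IUTFork.Cor312Prov Summit.ABC.IUTFork.Repair.RH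

variable {F K Fbar : Type} [Field F] [NumberField F] [Field K] [NumberField K] [Algebra F K] [Field Fbar]
  [Algebra F Fbar] [Algebra K Fbar] {E : WeierstrassCurve F} [E.IsElliptic] {l : ℕ} {Pb : BadPlacePredicates K}
  (D : InitialThetaData F K Fbar E l Pb)

/-- **CARD↔tree probe (row 16).** The landed `HStarDiffPriced D` (p458364) is LITERALLY the CARD-diffpriced sentence: at every bad place
`w ∣ p` of `pilotDataOfK D K` and every label `j = i+1`, `(j² − 1)·P_w ≤ j·(e_w·d_w)` with `P_w = qPilot w`, `e_w = absRamificationIdx p K_w`,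
`d_w = differentOrd p K_w`. [R-H candidate, hypothesis — not a fact] [cite: Mochizuki2012, IUTchIV Prop. 1.1 p. 9] [claim: Mochizuki2012, status: disputed] -/
theorem hStarDiffPriced_iff :
    DiffPriced.HStarDiffPriced D ↔
      ∀ (pp : Nat.Primes) (i : Fin (pilotDataOfK D K).lstar) (w : (thetaIndex (pilotDataOfK D K)).Fibre (.inr pp)),
        haveI : Fact (pp : ℕ).Prime := ⟨pp.2⟩
        placeOf (pilotDataOfK D K) pp.1 w ∈ (pilotDataOfK D K).S →
          ((((i : ℕ) + 1 : ℕ) : ℝ) ^ 2 - 1) * (pilotDataOfK D K).qPilot (placeOf (pilotDataOfK D K) pp.1 w) ≤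
            (((i : ℕ) + 1 : ℕ) : ℝ) * ((absRamificationIdx (pp : ℕ) (kOf (pilotDataOfK D K) pp.1 w) : ℝ) *
              differentOrd (pp : ℕ) (kOf (pilotDataOfK D K) pp.1 w)) :=
  Iff.rfl

/-- **ROW 16 ⟹ ROW 5 at every genuine `K`-level datum.** At a TAME bad place (`p > 2`, `e_w ≤ p − 2`, whence `p ∤ e_w` and
`e_w·d_w = e_w − 1`, `differentOrd_eq_of_not_dvd`) H⋆_𝔡's cell is the band top `(j²−1)·P_w ≤ j·(e_w − 1)`, which implies row 5's cell
(`TameBandLicence.cell_of_bandTop`); at wild / boundary places row 5 demands nothing. [cite: SerreLocalFields1979, Ch. III §6 Prop. 13]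
[cite: Mochizuki2012, IUTchI Ex. 3.2 (iv) p. 71; IUTchIV Prop. 1.1 p. 9] [claim: Mochizuki2012, status: disputed] -/
theorem hStarTameBandLicence_of_hStarDiffPriced (h : DiffPriced.HStarDiffPriced D) :
    TameBandLicence.HStarTameBandLicence D := by
  intro pp i w hw hp2 hew P hP
  haveI : Fact (pp : ℕ).Prime := ⟨pp.2⟩
  have heK : absRamificationIdx (pp : ℕ) (kOf (pilotDataOfK D K) pp.1 w) =
      (placeOf (pilotDataOfK D K) pp.1 w).asIdeal.ramificationIdx ℤ :=
    absRamificationIdx_rescaledCompletion K (pp : ℕ) (placeOf (pilotDataOfK D K) pp.1 w)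
      (natCast_mem_placeOf (pilotDataOfK D K) pp.1 w)
  have he0 : 0 < (placeOf (pilotDataOfK D K) pp.1 w).asIdeal.ramificationIdx ℤ :=
    TameBandLicence.ramificationIdx_placeOf_pos D pp w
  have hnd : ¬ (pp : ℕ) ∣ absRamificationIdx (pp : ℕ) (kOf (pilotDataOfK D K) pp.1 w) := by
    rw [heK]
    intro hdvd
    have := Nat.le_of_dvd he0 hdvd
    omega
  have hd := differentOrd_eq_of_not_dvd (pp : ℕ) (kOf (pilotDataOfK D K) pp.1 w) hnd
  have hcell := h pp i w hw
  simp only [DiffPriced.Cell, hP, hd, heK] at hcell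
  have he0' : (((placeOf (pilotDataOfK D K) pp.1 w).asIdeal.ramificationIdx ℤ : ℕ) : ℝ) ≠ 0 := by
    exact_mod_cast he0.ne'
  have hmul : (((placeOf (pilotDataOfK D K) pp.1 w).asIdeal.ramificationIdx ℤ : ℕ) : ℝ) *
      (((((placeOf (pilotDataOfK D K) pp.1 w).asIdeal.ramificationIdx ℤ : ℕ) : ℝ) - 1) /
        (((placeOf (pilotDataOfK D K) pp.1 w).asIdeal.ramificationIdx ℤ : ℕ) : ℝ)) =
      (((placeOf (pilotDataOfK D K) pp.1 w).asIdeal.ramificationIdx ℤ : ℕ) : ℝ) - 1 := by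
    field_simp
  rw [hmul] at hcell
  have hint : ((((i : ℕ) + 1 : ℕ) : ℤ) ^ 2 - 1) * (P : ℤ) ≤
      (((i : ℕ) + 1 : ℕ) : ℤ) * ((((placeOf (pilotDataOfK D K) pp.1 w).asIdeal.ramificationIdx ℤ : ℕ) : ℤ) - 1) := by
    have h' : ((((((i : ℕ) + 1 : ℕ) : ℤ) ^ 2 - 1) * (P : ℤ) : ℤ) : ℝ) ≤
        (((((i : ℕ) + 1 : ℕ) : ℤ) * ((((placeOf (pilotDataOfK D K) pp.1 w).asIdeal.ramificationIdx ℤ : ℕ) : ℤ) - 1) : ℤ) : ℝ) := by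
      push_cast at hcell ⊢
      linarith
    exact_mod_cast h'
  exact TameBandLicence.cell_of_bandTop (by exact_mod_cast he0.ne') hint

/-- **The converse fails cell-wise (row 5 ⊋ row 16 inside row 5's scope).** At `(e, P, j) = (5, 3, 2)` (HEX:3:5@p7.j2.ev1), `(2, 1, 2)`
(S-X72@p7.j2) and `(35, 15, 3)` (the `l = 7`, `H = 6` frey tame rows) row 5's cell `(j²−1)P ≤ j(e−1) + ((j²P−1) mod e)` HOLDS while row 16's
tame cell `(j²−1)P ≤ j(e−1)` FAILS — the remainder `(j²P − 1) mod e ∈ {1, 1, 29}` is exactly what separates them. [folklore] -/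
theorem strict_witnesses :
    (TameBandLicence.Cell 5 3 2 ∧ ¬ (((2 : ℤ) ^ 2 - 1) * 3 ≤ 2 * (5 - 1))) ∧
      (TameBandLicence.Cell 2 1 2 ∧ ¬ (((2 : ℤ) ^ 2 - 1) * 1 ≤ 2 * (2 - 1))) ∧
      (TameBandLicence.Cell 35 15 3 ∧ ¬ (((3 : ℤ) ^ 2 - 1) * 15 ≤ 3 * (35 - 1))) := by
  simp only [TameBandLicence.Cell]
  decide

/-- **ONE unramified odd bad place refutes H⋆_𝔡 as typed** (`e_w = 1`, `p > 2`: the tame cell at `j = 2` reads `3·P_w ≤ 0`): row 16 inherits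
row 5's `not_hStar_of_unramified_bad` — the CARD's declared H4 line «e_w = 1 ⇒ NEG» as a theorem at the genuine datum, agreeing with
`CandInternal2Real.not_mem_jsq_smul_logShell_of_unramified` and with the licence's own refutation there ((L2) ceiling).
[cite: Mochizuki2012, IUTchI Ex. 3.2 (iv) p. 71] [claim: Mochizuki2012, status: disputed] -/
theorem not_hStarDiffPriced_of_unramified_bad (pp : Nat.Primes) (w : (thetaIndex (pilotDataOfK D K)).Fibre (.inr pp))
    (hp2 : 2 < (pp : ℕ))
    (hw : haveI : Fact (pp : ℕ).Prime := ⟨pp.2⟩; placeOf (pilotDataOfK D K) pp.1 w ∈ (pilotDataOfK D K).S)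
    (he : haveI : Fact (pp : ℕ).Prime := ⟨pp.2⟩; (placeOf (pilotDataOfK D K) pp.1 w).asIdeal.ramificationIdx ℤ = 1) :
    ¬ DiffPriced.HStarDiffPriced D := fun h =>
  TameBandLicence.not_hStar_of_unramified_bad D pp w hp2 hw he (hStarTameBandLicence_of_hStarDiffPriced D h)

/-! ## The k2 target shape for row 16 on the tame stratum (START-HERE §3 (k2)), from row 5's door -/

variable {logv : PadicLogs K} (hlog : LogvAnalytic logv)
  (M : Type) [Field M] [NumberField M]
  (archPk : ∀ (j : (thetaIndex (pilotDataOfK D K)).Label) (vQ : (thetaIndex (pilotDataOfK D K)).VQ),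
    Set ((logShellsDH (pilotDataOfK D K) logv).Packet j vQ))
  (archSub : ∀ (j : (thetaIndex (pilotDataOfK D K)).Label) (v : (thetaIndex (pilotDataOfK D K)).V),
    Set ((logShellsDH (pilotDataOfK D K) logv).Packet j ((thetaIndex (pilotDataOfK D K)).over v)))
  (Ψ : ℤ → ∀ v : (thetaIndex (pilotDataOfK D K)).V, v ∈ (thetaIndex (pilotDataOfK D K)).Vbad →
    Set ((logShellsDH (pilotDataOfK D K) logv).StarPacket v))
  (act : ℤ → ∀ v : (thetaIndex (pilotDataOfK D K)).V, v ∈ (thetaIndex (pilotDataOfK D K)).Vbad →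
    (logShellsDH (pilotDataOfK D K) logv).StarPacket v → Module.End ℚ ((logShellsDH (pilotDataOfK D K) logv).StarPacket v))
  (Mmod : ℤ → ∀ j : (thetaIndex (pilotDataOfK D K)).LabelStar, Set ((logShellsDH (pilotDataOfK D K) logv).GlobalPacket j.1))
  (region : ℤ → ∀ j : (thetaIndex (pilotDataOfK D K)).LabelStar, FinDivisor M → ∀ vQ : (thetaIndex (pilotDataOfK D K)).VQ,
    Set ((logShellsDH (pilotDataOfK D K) logv).Packet j.1 vQ))
  (n : ℤ) {HT : Type} {LogLink : HT → HT → Type} {IsFull : ∀ {s t : HT}, LogLink s t → Prop}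
  (lat : LGPGaussianLogThetaLattice LogLink IsFull)
  {Frd : Type} {IsoF : Frd → Frd → Type} {Ob : Frd → Type} {realify : Frd → Frd} {Strip : Type}
  {IsoS : Strip → Strip → Type} {Mv : ∀ v : (thetaIndex (pilotDataOfK D K)).V, v ∈ (thetaIndex (pilotDataOfK D K)).Vbad → Type}
  [∀ v h, Monoid (Mv v h)]
  (sig : GlobalLGPFrobenioidSignature (thetaIndex (pilotDataOfK D K)).lstar (thetaIndex (pilotDataOfK D K)).V
    (· ∈ (thetaIndex (pilotDataOfK D K)).Vbad) Frd IsoF Ob realify Strip IsoS Mv)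
  (split : SplittingMonoids Mv) {ObΔ : Type} {N : ∀ v : (thetaIndex (pilotDataOfK D K)).V, v ∈ (thetaIndex (pilotDataOfK D K)).Vbad → Type}
  [∀ v h, Monoid (N v h)] (qData : QPilotData ObΔ N)
  (tq : ∀ (pp : Nat.Primes) (x : (thetaIndex (pilotDataOfK D K)).Fibre (.inr pp)),
    haveI : Fact (pp : ℕ).Prime := ⟨pp.2⟩; kOf (pilotDataOfK D K) pp.1 x)
  (t : ∀ (pp : Nat.Primes) (_ : Fin (pilotDataOfK D K).lstar) (x : (thetaIndex (pilotDataOfK D K)).Fibre (.inr pp)),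
    haveI : Fact (pp : ℕ).Prime := ⟨pp.2⟩; kOf (pilotDataOfK D K) pp.1 x)
  (htq0 : ∀ pp x, tq pp x ≠ 0)
  (htq1 : ∀ (pp : Nat.Primes) (x : (thetaIndex (pilotDataOfK D K)).Fibre (.inr pp)),
    haveI : Fact (pp : ℕ).Prime := ⟨pp.2⟩; placeOf (pilotDataOfK D K) pp.1 x ∉ (pilotDataOfK D K).S → ‖tq pp x‖ = 1)
  (col : ℤ → Column (logShellsDH (pilotDataOfK D K) logv))
  (ht0 : ∀ pp i x, t pp i x ≠ 0)
  (ht : ∀ (pp : Nat.Primes) (i : Fin (pilotDataOfK D K).lstar) (x : (thetaIndex (pilotDataOfK D K)).Fibre (.inr pp)),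
    haveI : Fact (pp : ℕ).Prime := ⟨pp.2⟩
    Real.log ‖t pp i x‖ = -((pilotDataOfK D K).thetaPilot i (placeOf (pilotDataOfK D K) pp.1 x)) *
      logNorm K (placeOf (pilotDataOfK D K) pp.1 x) / localDegree K (placeOf (pilotDataOfK D K) pp.1 x))
  (htq : ∀ (pp : Nat.Primes) (x : (thetaIndex (pilotDataOfK D K)).Fibre (.inr pp)),
    haveI : Fact (pp : ℕ).Prime := ⟨pp.2⟩
    Real.log ‖tq pp x‖ = -((pilotDataOfK D K).qPilot (placeOf (pilotDataOfK D K) pp.1 x)) *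
      logNorm K (placeOf (pilotDataOfK D K) pp.1 x) / localDegree K (placeOf (pilotDataOfK D K) pp.1 x))

include ht0 ht htq in
/-- **k2 TARGET SHAPE FOR ROW 16 ON THE TAME STRATUM**: at a genuine datum all of whose bad fibres are uniformly tame, for REALISING Θ- and
q-ideles, H⋆_𝔡 ⟹ branch C's per-datum S_H antecedent «∃ ρ qK, QPinned ∧ PilotKummerCompatHull» at `settingPrVolSharp (pilotDataOfK D K) …`
(any columns `col`) — row 16 ⟹ row 5 ⟹ row 5's door `exists_qPinned_and_hull_settingPrVolSharp_pilotDataOfK_of_hStar_of_tame`. The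
WILD stratum is row 16's open content and is NOT touched. [cite: Mochizuki2012, IUTchIII Step (xi) (xi-f) p. 184; IUTchIV Prop. 1.1 p. 9]
[cite: DupuyHilado2025, §3.3, §3.4, §3.9, §4.9] [claim: Mochizuki2012, status: disputed] -/
theorem exists_qPinned_and_hull_settingPrVolSharp_pilotDataOfK_of_hStarDiffPriced_of_tame (e : Nat.Primes → ℕ)
    (htame : ∀ (pp : Nat.Primes) (x : (thetaIndex (pilotDataOfK D K)).Fibre (.inr pp)),
      haveI : Fact (pp : ℕ).Prime := ⟨pp.2⟩
      (∃ w : (thetaIndex (pilotDataOfK D K)).Fibre (.inr pp), placeOf (pilotDataOfK D K) pp.1 w ∈ (pilotDataOfK D K).S) →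
        2 < (pp : ℕ) ∧ e pp ≤ (pp : ℕ) - 2 ∧ (placeOf (pilotDataOfK D K) pp.1 x).asIdeal.ramificationIdx ℤ = e pp)
    (hH : DiffPriced.HStarDiffPriced D) :
    ∃ (ρ : (∀ v : (thetaIndex (pilotDataOfK D K)).V, v ∈ (thetaIndex (pilotDataOfK D K)).Vbad →
            Set ((logShellsDH (pilotDataOfK D K) logv).StarPacket v)) →
          ∀ (j : (thetaIndex (pilotDataOfK D K)).Label) (vQ : (thetaIndex (pilotDataOfK D K)).VQ),
            Set ((logShellsDH (pilotDataOfK D K) logv).Packet j vQ))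
        (qK : ∀ v : (thetaIndex (pilotDataOfK D K)).V, v ∈ (thetaIndex (pilotDataOfK D K)).Vbad →
          Set ((logShellsDH (pilotDataOfK D K) logv).StarPacket v)),
        QPinned ({ toSituation := situationPrVol (pilotDataOfK D K) hlog M archPk archSub Ψ act Mmod region, col := col } :
            LatticeSituation (thetaIndex (pilotDataOfK D K)))
          (settingPrVolSharp (pilotDataOfK D K) hlog M archPk archSub Ψ act Mmod region n lat sig split qData tq t htq0 htq1) ρ qK ∧
        PilotKummerCompatHull ({ toSituation := situationPrVol (pilotDataOfK D K) hlog M archPk archSub Ψ act Mmod region, col := col } :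
            LatticeSituation (thetaIndex (pilotDataOfK D K)))
          (settingPrVolSharp (pilotDataOfK D K) hlog M archPk archSub Ψ act Mmod region n lat sig split qData tq t htq0 htq1) ρ qK :=
  TameBandLicence.exists_qPinned_and_hull_settingPrVolSharp_pilotDataOfK_of_hStar_of_tame D hlog M archPk archSub Ψ act Mmod region n
    lat sig split qData tq t htq0 htq1 col ht0 ht htq e htame (hStarTameBandLicence_of_hStarDiffPriced D hH)

/-! ## Appendix (row 16 second-engine certificate, seat abc-iut-rh-typ-5): at every bad place with TAME DIFFERENT (`p ∤ e_w` — the (T)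
and (T′) strata of CARD-diffpriced, i.e. every HEX/lamSeven row with `7 ∤ e_w` and every frey row of I06STAR-COLUMNS v4.1) the engines' recipe
`(j²−1)·m_q ≤ j·(e_w − 1)` (abc-iut-rh-num-1 17:23:27Z / this seat's `k1_row16.py`) IS the typed cell of p458364, by theorem — the row-16
twin of abc-iut-rh-typ-8's `hBand_iff_cells_of_strictMin` (p460197) -/

/-- **Recipe ≡ typed cell at a place with tame different.** At a fibre point `w ∣ p` of the genuine datum with `p ∤ e_w` and integral q-degree
`qPilot w = P`, for every label `j`: `DiffPriced.Cell j (qPilot w) e(K_w/ℚ_p) d(K_w/ℚ_p) ⟺ (j² − 1)·P ≤ j·(e_w − 1)` — `e(K_w/ℚ_p) = e_w`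
(`absRamificationIdx_rescaledCompletion`) and `e_w·d_w = e_w − 1` (`differentOrd_eq_of_not_dvd`, tame different). No shell-tameness `e_w ≤ p − 2`
is needed: the deep-shell places with `p ∤ e_w` ((T′)) are covered. [cite: SerreLocalFields1979, Ch. III §6 Prop. 13]
[cite: Mochizuki2012, IUTchIV Prop. 1.1 p. 9] [claim: Mochizuki2012, status: disputed] -/
theorem diffPricedCell_iff_bandTop_of_not_dvd (pp : Nat.Primes) (w : (thetaIndex (pilotDataOfK D K)).Fibre (.inr pp))
    (hnd : haveI : Fact (pp : ℕ).Prime := ⟨pp.2⟩; ¬ (pp : ℕ) ∣ (placeOf (pilotDataOfK D K) pp.1 w).asIdeal.ramificationIdx ℤ)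
    {P : ℕ} (hP : haveI : Fact (pp : ℕ).Prime := ⟨pp.2⟩; (pilotDataOfK D K).qPilot (placeOf (pilotDataOfK D K) pp.1 w) = P) (j : ℕ) :
    haveI : Fact (pp : ℕ).Prime := ⟨pp.2⟩
    DiffPriced.Cell j ((pilotDataOfK D K).qPilot (placeOf (pilotDataOfK D K) pp.1 w))
        (absRamificationIdx (pp : ℕ) (kOf (pilotDataOfK D K) pp.1 w)) (differentOrd (pp : ℕ) (kOf (pilotDataOfK D K) pp.1 w)) ↔
      (((j : ℕ) : ℤ) ^ 2 - 1) * (P : ℤ) ≤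
        ((j : ℕ) : ℤ) * ((((placeOf (pilotDataOfK D K) pp.1 w).asIdeal.ramificationIdx ℤ : ℕ) : ℤ) - 1) := by
  haveI : Fact (pp : ℕ).Prime := ⟨pp.2⟩
  have heK : absRamificationIdx (pp : ℕ) (kOf (pilotDataOfK D K) pp.1 w) =
      (placeOf (pilotDataOfK D K) pp.1 w).asIdeal.ramificationIdx ℤ :=
    absRamificationIdx_rescaledCompletion K (pp : ℕ) (placeOf (pilotDataOfK D K) pp.1 w)
      (natCast_mem_placeOf (pilotDataOfK D K) pp.1 w)
  have he0 : 0 < (placeOf (pilotDataOfK D K) pp.1 w).asIdeal.ramificationIdx ℤ :=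
    TameBandLicence.ramificationIdx_placeOf_pos D pp w
  have hd := differentOrd_eq_of_not_dvd (pp : ℕ) (kOf (pilotDataOfK D K) pp.1 w) (by rw [heK]; exact hnd)
  simp only [DiffPriced.Cell, hP, hd, heK]
  have he0' : (((placeOf (pilotDataOfK D K) pp.1 w).asIdeal.ramificationIdx ℤ : ℕ) : ℝ) ≠ 0 := by
    exact_mod_cast he0.ne'
  have hmul : (((placeOf (pilotDataOfK D K) pp.1 w).asIdeal.ramificationIdx ℤ : ℕ) : ℝ) *
      (((((placeOf (pilotDataOfK D K) pp.1 w).asIdeal.ramificationIdx ℤ : ℕ) : ℝ) - 1) /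
        (((placeOf (pilotDataOfK D K) pp.1 w).asIdeal.ramificationIdx ℤ : ℕ) : ℝ)) =
      (((placeOf (pilotDataOfK D K) pp.1 w).asIdeal.ramificationIdx ℤ : ℕ) : ℝ) - 1 := by
    field_simp
  rw [hmul]
  constructor
  · intro h
    have h' : (((((j : ℕ) : ℤ) ^ 2 - 1) * (P : ℤ) : ℤ) : ℝ) ≤
        ((((j : ℕ) : ℤ) * ((((placeOf (pilotDataOfK D K) pp.1 w).asIdeal.ramificationIdx ℤ : ℕ) : ℤ) - 1) : ℤ) : ℝ) := by
      push_cast at h ⊢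
      linarith
    exact_mod_cast h'
  · intro h
    have h' : (((((j : ℕ) : ℤ) ^ 2 - 1) * (P : ℤ) : ℤ) : ℝ) ≤
        ((((j : ℕ) : ℤ) * ((((placeOf (pilotDataOfK D K) pp.1 w).asIdeal.ramificationIdx ℤ : ℕ) : ℤ) - 1) : ℤ) : ℝ) := by
      exact_mod_cast h
    push_cast at h' ⊢
    linarith

/-- **… hence, at a genuine datum all of whose BAD places have tame different (`p ∤ e_w`), H⋆_𝔡 IS the integer recipe** «at every bad `w ∣ p`
and every label `j = i+1`: `(j²−1)·P_w ≤ j·(e_w − 1)`» (`P_w ∈ ℕ` the integral q-degree, `Cor312Prov.exists_nat_qPilot_pilotDataOfK`). On such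
data the second engine's verdict column for row 16 is the typed decl's truth value, cell by cell. [cite: Mochizuki2012, IUTchI Ex. 3.2 (iv) p. 71;
IUTchIV Prop. 1.1 p. 9] [cite: SerreLocalFields1979, Ch. III §6 Prop. 13] [claim: Mochizuki2012, status: disputed] -/
theorem hStarDiffPriced_iff_bandTop_of_not_dvd
    (hnd : ∀ (pp : Nat.Primes) (w : (thetaIndex (pilotDataOfK D K)).Fibre (.inr pp)),
      haveI : Fact (pp : ℕ).Prime := ⟨pp.2⟩
      placeOf (pilotDataOfK D K) pp.1 w ∈ (pilotDataOfK D K).S →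
        ¬ (pp : ℕ) ∣ (placeOf (pilotDataOfK D K) pp.1 w).asIdeal.ramificationIdx ℤ) :
    DiffPriced.HStarDiffPriced D ↔
      ∀ (pp : Nat.Primes) (i : Fin (pilotDataOfK D K).lstar) (w : (thetaIndex (pilotDataOfK D K)).Fibre (.inr pp)),
        haveI : Fact (pp : ℕ).Prime := ⟨pp.2⟩
        placeOf (pilotDataOfK D K) pp.1 w ∈ (pilotDataOfK D K).S →
          ∀ P : ℕ, (pilotDataOfK D K).qPilot (placeOf (pilotDataOfK D K) pp.1 w) = P →
            ((((i : ℕ) + 1 : ℕ) : ℤ) ^ 2 - 1) * (P : ℤ) ≤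
              (((i : ℕ) + 1 : ℕ) : ℤ) * ((((placeOf (pilotDataOfK D K) pp.1 w).asIdeal.ramificationIdx ℤ : ℕ) : ℤ) - 1) := by
  constructor
  · intro h pp i w hw P hP
    haveI : Fact (pp : ℕ).Prime := ⟨pp.2⟩
    exact (diffPricedCell_iff_bandTop_of_not_dvd D pp w (hnd pp w hw) hP ((i : ℕ) + 1)).1 (h pp i w hw)
  · intro h pp i w hw
    haveI : Fact (pp : ℕ).Prime := ⟨pp.2⟩
    obtain ⟨P, hP, -, -⟩ := exists_nat_qPilot_pilotDataOfK D hw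
    exact (diffPricedCell_iff_bandTop_of_not_dvd D pp w (hnd pp w hw) hP ((i : ℕ) + 1)).2 (h pp i w hw P hP)

end Summit.ABC.IUTFork.Repair.RH.DiffPricedVsTameBand

end
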